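import Summits.QuantumFields.BalabanUV.Beta.GAN24.WrecAtEvenHalfRowsOfQLSourcePairForm
import Summits.QuantumFields.BalabanUV.Beta.GAN24.LegRowsOfWindows

/-!
# `BalabanUV.Beta.GAN24.WrecAtEvenHalfRowsOfWindows` — binder row G-an2-4 ∕ (CONV-C), W-slot, the (α-0) parity re-cut: **ROAD FP's D1 LITERAL OF RECORD FROM THE
# THREE WINDOWS ON THE RULED CLASS, THE SOURCE ∕ SLAVED ROWS, AND (C)sym — (H2)∕(H2d) GONE** (G-an2-4 formalisation swarm, leaf prover `b2b-balaban-gan24-formalise-leaf-03`,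
# gen 68; FILE 5 of the journal INTENT [LEAF03-G68-ONLINE] «(H2) ⟸ THE SAME WINDOWS»; the twin of MY g67 FILE 9 `WrecAtEvenHalfRowsOfRuledChainRows` (p367507) one display
# lower: p2 g46's capstone `WrecAtEvenHalfRowsOfQLCSym.exists_allScalesSeq_JsRowD1Pin_of_QL_CSym` (the D1 literal ⟸ the eight pins ∧ `2 ≤ N` ∧ `hL₁ hL₂ hL₁′ hL₂′` ∧ (C)sym)
# with the (Q-L) group DISCHARGED by MY FILE 4 `LegRowsOfWindows` instead of FILE 8b)

**END-STATE TWIN (step 1 of 4; leaf-03 g70, regenerated from leaf-03's staged bytes by `gen/mk_twins.py`; recipe = road-P2 gan24-p2 g49 W-1 l.55974 ∕ offer W-2 l.56061, adopted by leaf-03 g69 W-2 l.56945):** leaf-03 g68 FILE 5 v3 `WrecAtEvenHalfRowsOfWindows` 6ee1084208615753 RE-ROOTED on road-P2 g49 F11 `WrecAtEvenHalfRowsOfQLSourcePairForm`: the (C)sym binder `hS` ↦ the two binders `hSrc hSrcX` (per level `l ≥ 1` the leg-and-bond symmetrised `rowC` SOURCE charge is a PAIR FORM, and its CROSSED orbit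 sums vanish — texts byte-identical to F11's, from road-P2's `gen49/gen/mk_tower_defs.py`), import ∕ open ∕ namespace ∕ theorem name ∕ the pass-through call swapped accordingly. An ADDITIONAL file: the (C)sym original stands as staged ∕ filed. Discharges NOTHING of `hSrc` ∕ `hSrcX`.

NOT IN PRINT; OUR BOOKKEEPING ([folklore] composition BY NAME; 0 `def`, 0 cited facts, 0 `def … : Prop`, 0 sorry).  HONEST FRAMING (cell contract, verbatim):
«discharging `BetaPertH` makes Bałaban's UV stability UNCONDITIONAL — a real constructive-QFT result; it is NOT the continuum limit and NOT the Clay problem.»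
HONEST DEPENDENCY (verbatim): «continuum YM on T⁴ ⇐ BetaPertH ∧ nine spine estimates (0/9 proved); BetaPertH ⇐ (D1) ∧ (D4) ∧ CAP+tail; G-an2-4 gates asym, D1
and NE2/3/4.»

WHAT (`d = 3`, `Lc` odd, `2 ≤ Lc`, `2 ≤ N`, root `r = ctrOff 4 Lc`, the eight pins, `Tc = (8N²)⁻¹ • wsym22 N`, border `vh₂SAn1 Lc`, `ε := 1`):
**`exists_allScalesSeq_JsRowD1Pin_of_windows_CSym`** — `∃ κ θ, 0 ≤ θ < 1 ∧ AllScalesSeq (j ↦ secondMoment (TbalOf Lc (JsRowD1Pin …) j) μ ν) κ θ`, for EVERY triple of rates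
`0 < δD ≤ δ` and `δS` (no `δ₀`, no `∃ k₀`-order issue: every displayed rate is fixed before `k₀`), from EXACTLY:
(H1♮ on 𝒫)_δ and (H1♮ on 𝒫)_{δD} (the k₀-windows of the shape and of the drift tower), (H1w)_{δS→δ} ∕ (HwD)_{δS→δD} (the short windows `q < k₀` from the sources'
rate, no contraction), (H1Δw)_{δ→δD} (the composite kernel-drift windows, `ν^l`) — instances ∕ variants of ONE window theorem at THREE rates `δS`, `δ ≥ δD` (A-3's rate ledger), all asked only on the RULED CLASS `𝒫 W :≡ (jointly Lc-covariant) ∧ (∀ N′ κ κ′ a b,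
zmode N′ W κ κ′ a b = 0) ∧ (∃ C′ δ′ > 0, LocStencil₂ W C′ δ′)` —; the per-level SOURCE rows (HS)_δ `LocStencil₂ (rdiv ∘ F_n) C_F δ`, (HSL) `GoodL (rdiv ∘ F_n) g_F`, (HS′)_δ
(source drift, `C_F′·ν^l`), (HSL′); the INITIAL member's rows (Hx0)_{δS} ∕ (HxL0) (the first windows (H0)∕(H0d) are the short windows' — FILE 1 v1.2 ∕ FILE 4); the slaved
longitudinal amplitude (H3) ∕ (H3d); and (C)sym `hS`.  Border data, parities, S-rows, table laws, scalar rows: ALL BY NAME upstream (p2 g46, leaf-01 g73, d1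
lineages).  THIS IS WHERE ROAD FP's D1 LITERAL STANDS ON THE G-an2-4 SIDE: ⟸ the window theorem on 𝒫 (leaf-01 g74's `locStencil₂_legChain_bsumPow_of_dressed_envelopes{,_of_blockL1}`
+ the OWNER's block-ℓ¹ parts 1–5 + (E-c) + `LegWindowArithmetic`) ∧ the source ∕ slaved rows [letter rows; suppliers named] ∧ (C)sym [an2 ∕ leaf-06].  Asserts NO shape of
Bałaban's tables beyond these rows and NO value of any charge; discharges NOTHING of (H1♮) ∕ (H1w) ∕ (H1Δ) ∕ (C)sym ∕ (β); NOT «W-slot closed»; NEVER «G-an2-4 closed» as (CONV-C);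
NOT D1 (the literal is ONE road-FP instance under displayed rows), NOT `BetaPertH`, NOT continuum, NOT Clay; not in print.  Unit `b2b-balaban-gan24-formalise-leaf-03` (gen 68),
2026-08-23.
-/

noncomputable section

open Finset
open scoped BigOperators
open Literature.MathematicalPhysics.QuantumFieldTheory
open Literature.MathematicalPhysics.QuantumFieldTheory.Balaban1983to89
open Literature.MathematicalPhysics.QuantumFieldTheory.Balaban1983to89.Beta
open ExpKernelCalculus (MKer shiftK BiLoc Decays comp)
open OneStepResolventKernel (Fib LocStencil)
open OneStepKernelFamily (KInvStep TbalOf)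
open RemainderConstAllScales (AllScalesSeq)
open AveragingContoursRooted (ctrOff ctrOff_mem_box)
open WilsonVertex2Sym (wsym22)
open AffineAveraging (box toSite unitVec)
open AveragingMixedJetTables (mixFFAt)
open SecondOrderResponse (W2SymOfK)
open KernelWard (divV)
open BalabanCompositeJets (LocStencil₂)
open BalabanStepJetsSucc (mmRead)
open BalabanStepW2 (K3OfK M2Of)
open Summit.QuantumFields.BalabanUV.Beta.TameKernelCalculus (trK)
open Summit.QuantumFields.BalabanUV.Beta.BorderedHessian (sgnK diagK)
open Summit.QuantumFields.BalabanUV.Beta.AveragingWardRootedStencils (legInd)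
open Summit.QuantumFields.BalabanUV.Beta.HessKerDressedUnits (unitK unitS)
open Summit.QuantumFields.BalabanUV.Beta.SecondOrderUnits (unitM unitS₂ unitM₂)
open Summit.QuantumFields.BalabanUV.Beta.AxialDressingRooted (coDressKBmAt)
open Summit.QuantumFields.BalabanUV.Beta.SpineRooted (T2RecOf T2RecAt SpureRecAt M1At e3OfK)
open Summit.QuantumFields.BalabanUV.Beta.SecondOrderSocketIdentification (vh₂SAn1 vh₂SAn1_inl_inl vh₂SAn1_inr_inr)
open Summit.QuantumFields.BalabanUV.Beta.SecondOrderTableLawEnd (locStencil₂_vh₂SAn1 vh₂SAn1_translate)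
open Summit.QuantumFields.BalabanUV.Beta.RowD1JointEnd (JsRowD1Pin)
open Summit.QuantumFields.BalabanUV.Beta.GAN24.CombesThomas (sfStep smStep)
open Summit.QuantumFields.BalabanUV.Beta.GAN24.T2RecursionAffine (lin4)
open Summit.QuantumFields.BalabanUV.Beta.GAN24.BiStencilZeroMode (zmode)
open Summit.QuantumFields.BalabanUV.Beta.GAN24.AffineUnroll (transport)
open Summit.QuantumFields.BalabanUV.Beta.GAN24.Lin4LegTower (rdiv)
open Summit.QuantumFields.BalabanUV.Beta.GAN24.Lin4LegTowerUnroll (legStepB bsumPow legChain)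
open Summit.QuantumFields.BalabanUV.Beta.GAN24.WrecAtEvenHalfRowsOfQLSourcePairForm (exists_allScalesSeq_JsRowD1Pin_of_QL_sourcePairForm)
open Summit.QuantumFields.BalabanUV.Beta.GAN24.LegRowsOfWindows (legRows_halfMember_three_of_windows legDriftRows_halfMember_three_of_windows)

namespace Summit.QuantumFields.BalabanUV.Beta.GAN24.WrecAtEvenHalfRowsOfWindowsSourcePairForm

variable {Lc : ℕ} [NeZero Lc]

/-- NOT IN PRINT; OUR BOOKKEEPING.  **ROAD FP's D1 LITERAL FROM THE THREE WINDOWS ON THE RULED CLASS, THE SOURCE ∕ SLAVED ROWS, AND (C)sym** — p2 g46's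
`exists_allScalesSeq_JsRowD1Pin_of_QL_CSym` with `hδ hθL0 hθL1 hL₁ hL₂ hL₁′ hL₂′` discharged by MY FILE 4 at `ε := 1` (`θL := ϑ`, `CL := M + (Cg·σ + k₀·(A·C_F + B·g_F))·(1−θ)⁻¹`,
`CL′ := c`; the shape rows weakened from `δ` to the drift rate `δD ≤ δ` by `LocStencil₂.mono`, the literal read at `δD > 0`); border shape ∕ classes ∕ covariance of `vh₂SAn1` by d1's
`locStencil₂_vh₂SAn1 ∕ vh₂SAn1_inl_inl ∕ vh₂SAn1_inr_inr ∕ vh₂SAn1_translate`.  Displayed: the pins, the five window rows on 𝒫, (HS)(HSL)(Hx0)(HxL0)(H3), (HS′)(HSL′)(H3d), (C)sym —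
NO (H2)∕(H2d), NO (H0)∕(H0d). -/
theorem exists_allScalesSeq_JsRowD1Pin_of_windows_sourcePairForm (hLc : Odd Lc) (hL2 : 2 ≤ Lc) {N : ℕ} (hN : 2 ≤ N) {r : Fin (3 + 1) → ℕ} (hr : r = ctrOff (3 + 1) Lc)
    {cE cVH cΛ cE₂ cB : ℝ} (hcE : cE = (Lc : ℝ) ^ (3 + 1)) (hcVH : cVH = -((Lc : ℝ) ^ (3 + 1) * (1 / 2) * (Lc : ℝ) ^ (3 + 1))) (hcΛ : cΛ = 2 / (Lc : ℝ) ^ 4) (hcE₂ : cE₂ = (Lc : ℝ) ^ (2 * (3 + 1)))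
    (hcB : cB = -((Lc : ℝ) ^ 12 / 4)) {Tc : Fin 4 → Fin 4 → Fin 4 → Fin 4 → ℝ} (hTc : Tc = (8 * (N : ℝ) ^ 2)⁻¹ • wsym22 N)
    {vh₂S : Fin (3 + 1) → (Fin (3 + 1) → ℤ) → Fin (3 + 1) → (Fin (3 + 1) → ℤ) → MKer (3 + 1) (Fib 3)} (hvh : vh₂S = vh₂SAn1 Lc)
    {GoodL GoodLS GoodLD : (Fin (3 + 1) → (Fin (3 + 1) → ℤ) → Fin (3 + 1) → (Fin (3 + 1) → ℤ) → MKer (3 + 1) (Fib 3)) → ℝ → Prop} {δ δS δD : ℝ} (hδD : 0 < δD) (hδDδ : δD ≤ δ)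
    {k₀ : ℕ} (hk : 0 < k₀) {θ Cg A B CF gF C₀ g₀ σ : ℝ} (hθ0 : 0 ≤ θ) (hθ1 : θ < 1) (hCg : 0 ≤ Cg) (hA0 : 0 ≤ A) (hB0 : 0 ≤ B) (hCF : 0 ≤ CF) (hgF : 0 ≤ gF)
    (hC₀ : 0 ≤ C₀) (hg₀ : 0 ≤ g₀) (hσ : 0 ≤ σ)
    (H1 : ∀ n (W : (Fin (3 + 1) → (Fin (3 + 1) → ℤ) → Fin (3 + 1) → (Fin (3 + 1) → ℤ) → MKer (3 + 1) (Fib 3))) (C g : ℝ), (fun W : (Fin (3 + 1) → (Fin (3 + 1) → ℤ) → Fin (3 + 1) → (Fin (3 + 1) → ℤ) → MKer (3 + 1) (Fib 3)) =>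
      (∀ (κ : Fin (3 + 1)) (u : Fin (3 + 1) → ℤ) (κ' : Fin (3 + 1)) (u' t : Fin (3 + 1) → ℤ),
          W κ (u + (Lc : ℤ) • t) κ' (u' + (Lc : ℤ) • t) = shiftK (-((Lc : ℤ) • t)) (W κ u κ' u')) ∧
      (∀ (N' : ℕ) (κ κ' : Fin (3 + 1)) (a b : Fib 3), zmode N' W κ κ' a b = 0) ∧
      (∃ C' δ' : ℝ, 0 < δ' ∧ LocStencil₂ W C' δ')) W →
      (∃ B : ℝ, ∀ κ u κ' u' x z a b, |W κ u κ' u' x z a b| ≤ B) → LocStencil₂ W C δ → GoodL W g →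
        LocStencil₂ (legChain (fun _ : ℕ => -((cE₂ * (Lc : ℝ) ^ (2 * (3 + 1))) * ((Lc : ℝ) ^ (3 + 1))⁻¹))
          (fun m => unitK (sfStep Lc m) (smStep 3 Lc m) (coDressKBmAt (toSite r) Lc (KInvStep (d := 3) Lc m))) Lc n k₀
          (fun κ u κ' u' => bsumPow Lc k₀ (W κ u κ' u'))) (θ * C + Cg * g) δ)
    (Hw : ∀ p q (W : (Fin (3 + 1) → (Fin (3 + 1) → ℤ) → Fin (3 + 1) → (Fin (3 + 1) → ℤ) → MKer (3 + 1) (Fib 3))) (C g : ℝ), q < k₀ → (fun W : (Fin (3 + 1) → (Fin (3 + 1) → ℤ) → Fin (3 + 1) → (Fin (3 + 1) → ℤ) → MKer (3 + 1) (Fib 3)) =>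
      (∀ (κ : Fin (3 + 1)) (u : Fin (3 + 1) → ℤ) (κ' : Fin (3 + 1)) (u' t : Fin (3 + 1) → ℤ),
          W κ (u + (Lc : ℤ) • t) κ' (u' + (Lc : ℤ) • t) = shiftK (-((Lc : ℤ) • t)) (W κ u κ' u')) ∧
      (∀ (N' : ℕ) (κ κ' : Fin (3 + 1)) (a b : Fib 3), zmode N' W κ κ' a b = 0) ∧
      (∃ C' δ' : ℝ, 0 < δ' ∧ LocStencil₂ W C' δ')) W →
      (∃ B : ℝ, ∀ κ u κ' u' x z a b, |W κ u κ' u' x z a b| ≤ B) → LocStencil₂ W C δS → GoodLS W g →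
        LocStencil₂ (legChain (fun _ : ℕ => -((cE₂ * (Lc : ℝ) ^ (2 * (3 + 1))) * ((Lc : ℝ) ^ (3 + 1))⁻¹))
          (fun m => unitK (sfStep Lc m) (smStep 3 Lc m) (coDressKBmAt (toSite r) Lc (KInvStep (d := 3) Lc m))) Lc p q
          (fun κ u κ' u' => bsumPow Lc q (W κ u κ' u'))) (A * C + B * g) δ)
    (HS : ∀ n, LocStencil₂ (fun κ u κ' u' => rdiv ((((1 : ℝ) / 2) • ((fun κ u κ' u' => (cE₂ * (Lc : ℝ) ^ (2 * (3 + 1))) • mmRead Lc (K3OfK (unitK (sfStep Lc n) (smStep 3 Lc n) (coDressKBmAt (toSite r) Lc (KInvStep (d := 3) Lc n))) Lc (unitS (sfStep Lc n) (smStep 3 Lc n) (SpureRecAt 3 Lc (toSite r) cE cVH cΛ n)) (unitM (sfStep Lc n) (smStep 3 Lc n) (M1At 3 Lc (toSite r) cΛ n)) (W2SymOfK (unitK (sfStep Lc n) (smStep 3 Lc n) (coDressKBmAt (toSite r) Lc (KInvStep (d := 3) Lc n))) Lc (unitS (sfStep Lc n) (smStep 3 Lc n) (SpureRecAt 3 Lc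 (toSite r) cE cVH cΛ n)) (unitM (sfStep Lc n) (smStep 3 Lc n) (M1At 3 Lc (toSite r) cΛ n)) 0 (unitM₂ (sfStep Lc n) (smStep 3 Lc n) (M2Of 3 Lc (mixFFAt (toSite r) Lc) n))) κ u κ' u') + cB • vh₂S κ u κ' u') + (1 : ℝ) • fun κ u κ' u' => sgnK (trK (((fun κ u κ' u' => (cE₂ * (Lc : ℝ) ^ (2 * (3 + 1))) • mmRead Lc (K3OfK (unitK (sfStep Lc n) (smStep 3 Lc n) (coDressKBmAt (toSite r) Lc (KInvStep (d := 3) Lc n))) Lc (unitS (sfStep Lc n) (smStep 3 Lc n) (SpureRecAt 3 Lc (toSite r) cE cVH cΛ n)) (unitM (sfStep Lc n) (smStep 3 Lc n) (M1At 3 Lc (toSite r) cΛ n)) (W2SymOfK (unitK (sfStep Lc n) (smStep 3 Lc n) (coDressKBmAt (toSite r) Lc (KInvStep (d := 3) Lc n))) Lc (unitS (sfStep Lc n) (smStep 3 Lc n) (SpureRecAt 3 Lc (toSite r) cE cVH cΛ n)) (unitM (sfStep Lc n) (smStep 3 Lc n) (M1At 3 Lc (toSite r) cΛ n)) 0 (unitM₂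 (sfStep Lc n) (smStep 3 Lc n) (M2Of 3 Lc (mixFFAt (toSite r) Lc) n))) κ u κ' u') + cB • vh₂S κ u κ' u')) κ u κ' u')))) κ u κ' u')) CF δS)
    (HSL : ∀ n, GoodLS (fun κ u κ' u' => rdiv ((((1 : ℝ) / 2) • ((fun κ u κ' u' => (cE₂ * (Lc : ℝ) ^ (2 * (3 + 1))) • mmRead Lc (K3OfK (unitK (sfStep Lc n) (smStep 3 Lc n) (coDressKBmAt (toSite r) Lc (KInvStep (d := 3) Lc n))) Lc (unitS (sfStep Lc n) (smStep 3 Lc n) (SpureRecAt 3 Lc (toSite r) cE cVH cΛ n)) (unitM (sfStep Lc n) (smStep 3 Lc n) (M1At 3 Lc (toSite r) cΛ n)) (W2SymOfK (unitK (sfStep Lc n) (smStep 3 Lc n) (coDressKBmAt (toSite r) Lc (KInvStep (d := 3) Lc n))) Lc (unitS (sfStep Lc n) (smStep 3 Lc n) (SpureRecAt 3 Lc (toSite r) cE cVH cΛ n)) (unitM (sfStep Lc n) (smStep 3 Lc n) (M1At 3 Lc (toSite r) cΛ n)) 0 (unitM₂ (sfStep Lc n) (smStep 3 Lc n) (M2Of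 3 Lc (mixFFAt (toSite r) Lc) n))) κ u κ' u') + cB • vh₂S κ u κ' u') + (1 : ℝ) • fun κ u κ' u' => sgnK (trK (((fun κ u κ' u' => (cE₂ * (Lc : ℝ) ^ (2 * (3 + 1))) • mmRead Lc (K3OfK (unitK (sfStep Lc n) (smStep 3 Lc n) (coDressKBmAt (toSite r) Lc (KInvStep (d := 3) Lc n))) Lc (unitS (sfStep Lc n) (smStep 3 Lc n) (SpureRecAt 3 Lc (toSite r) cE cVH cΛ n)) (unitM (sfStep Lc n) (smStep 3 Lc n) (M1At 3 Lc (toSite r) cΛ n)) (W2SymOfK (unitK (sfStep Lc n) (smStep 3 Lc n) (coDressKBmAt (toSite r) Lc (KInvStep (d := 3) Lc n))) Lc (unitS (sfStep Lc n) (smStep 3 Lc n) (SpureRecAt 3 Lc (toSite r) cE cVH cΛ n)) (unitM (sfStep Lc n) (smStep 3 Lc n) (M1At 3 Lc (toSite r) cΛ n)) 0 (unitM₂ (sfStep Lc n) (smStep 3 Lc n) (M2Of 3 Lc (mixFFAt (toSite r) Lc) n))) κ u κ' u') + cB • vh₂S κ u κ' u')) κ u κ' u')))) κ u κ' u')) 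gF)
    (Hx0 : LocStencil₂ (fun κ u κ' u' => rdiv ((((1 : ℝ) / 2) • (unitS₂ (sfStep Lc 0) (smStep 3 Lc 0) (T2RecAt 3 Lc (toSite r) cE cVH cΛ cE₂ cB Tc vh₂S (mixFFAt (toSite r) Lc) 0) + (1 : ℝ) • fun κ u κ' u' => sgnK (trK ((unitS₂ (sfStep Lc 0) (smStep 3 Lc 0) (T2RecAt 3 Lc (toSite r) cE cVH cΛ cE₂ cB Tc vh₂S (mixFFAt (toSite r) Lc) 0)) κ u κ' u')))) κ u κ' u')) C₀ δS)
    (HxL0 : GoodLS (fun κ u κ' u' => rdiv ((((1 : ℝ) / 2) • (unitS₂ (sfStep Lc 0) (smStep 3 Lc 0) (T2RecAt 3 Lc (toSite r) cE cVH cΛ cE₂ cB Tc vh₂S (mixFFAt (toSite r) Lc) 0) + (1 : ℝ) • fun κ u κ' u' => sgnK (trK ((unitS₂ (sfStep Lc 0) (smStep 3 Lc 0) (T2RecAt 3 Lc (toSite r) cE cVH cΛ cE₂ cB Tc vh₂S (mixFFAt (toSite r) Lc) 0)) κ u κ' u')))) κ u κ' u')) g₀)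
    (H3 : ∀ n, GoodL (fun κ u κ' u' => rdiv ((((1 : ℝ) / 2) • (unitS₂ (sfStep Lc n) (smStep 3 Lc n) (T2RecAt 3 Lc (toSite r) cE cVH cΛ cE₂ cB Tc vh₂S (mixFFAt (toSite r) Lc) n) + (1 : ℝ) • fun κ u κ' u' => sgnK (trK ((unitS₂ (sfStep Lc n) (smStep 3 Lc n) (T2RecAt 3 Lc (toSite r) cE cVH cΛ cE₂ cB Tc vh₂S (mixFFAt (toSite r) Lc) n)) κ u κ' u')))) κ u κ' u')) σ)
    {θD CgD AD BD AΔ BΔ CF' gF' ν σd : ℝ} (hθD0 : 0 ≤ θD) (hθD1 : θD < 1) (hCgD : 0 ≤ CgD) (hAD : 0 ≤ AD) (hBD : 0 ≤ BD) (hAΔ : 0 ≤ AΔ) (hBΔ : 0 ≤ BΔ)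
    (hCF' : 0 ≤ CF') (hgF' : 0 ≤ gF') (hν0 : 0 ≤ ν) (hν1 : ν < 1) (hσd : 0 ≤ σd)
    (H1D : ∀ n (W : (Fin (3 + 1) → (Fin (3 + 1) → ℤ) → Fin (3 + 1) → (Fin (3 + 1) → ℤ) → MKer (3 + 1) (Fib 3))) (C g : ℝ), (fun W : (Fin (3 + 1) → (Fin (3 + 1) → ℤ) → Fin (3 + 1) → (Fin (3 + 1) → ℤ) → MKer (3 + 1) (Fib 3)) =>
      (∀ (κ : Fin (3 + 1)) (u : Fin (3 + 1) → ℤ) (κ' : Fin (3 + 1)) (u' t : Fin (3 + 1) → ℤ),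
          W κ (u + (Lc : ℤ) • t) κ' (u' + (Lc : ℤ) • t) = shiftK (-((Lc : ℤ) • t)) (W κ u κ' u')) ∧
      (∀ (N' : ℕ) (κ κ' : Fin (3 + 1)) (a b : Fib 3), zmode N' W κ κ' a b = 0) ∧
      (∃ C' δ' : ℝ, 0 < δ' ∧ LocStencil₂ W C' δ')) W →
      (∃ B : ℝ, ∀ κ u κ' u' x z a b, |W κ u κ' u' x z a b| ≤ B) → LocStencil₂ W C δD → GoodLD W g →
        LocStencil₂ (legChain (fun _ : ℕ => -((cE₂ * (Lc : ℝ) ^ (2 * (3 + 1))) * ((Lc : ℝ) ^ (3 + 1))⁻¹))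
          (fun m => unitK (sfStep Lc m) (smStep 3 Lc m) (coDressKBmAt (toSite r) Lc (KInvStep (d := 3) Lc m))) Lc n k₀
          (fun κ u κ' u' => bsumPow Lc k₀ (W κ u κ' u'))) (θD * C + CgD * g) δD)
    (HwD : ∀ p q (W : (Fin (3 + 1) → (Fin (3 + 1) → ℤ) → Fin (3 + 1) → (Fin (3 + 1) → ℤ) → MKer (3 + 1) (Fib 3))) (C g : ℝ), q < k₀ → (fun W : (Fin (3 + 1) → (Fin (3 + 1) → ℤ) → Fin (3 + 1) → (Fin (3 + 1) → ℤ) → MKer (3 + 1) (Fib 3)) =>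
      (∀ (κ : Fin (3 + 1)) (u : Fin (3 + 1) → ℤ) (κ' : Fin (3 + 1)) (u' t : Fin (3 + 1) → ℤ),
          W κ (u + (Lc : ℤ) • t) κ' (u' + (Lc : ℤ) • t) = shiftK (-((Lc : ℤ) • t)) (W κ u κ' u')) ∧
      (∀ (N' : ℕ) (κ κ' : Fin (3 + 1)) (a b : Fib 3), zmode N' W κ κ' a b = 0) ∧
      (∃ C' δ' : ℝ, 0 < δ' ∧ LocStencil₂ W C' δ')) W →
      (∃ B : ℝ, ∀ κ u κ' u' x z a b, |W κ u κ' u' x z a b| ≤ B) → LocStencil₂ W C δS → GoodLS W g →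
        LocStencil₂ (legChain (fun _ : ℕ => -((cE₂ * (Lc : ℝ) ^ (2 * (3 + 1))) * ((Lc : ℝ) ^ (3 + 1))⁻¹))
          (fun m => unitK (sfStep Lc m) (smStep 3 Lc m) (coDressKBmAt (toSite r) Lc (KInvStep (d := 3) Lc m))) Lc p q
          (fun κ u κ' u' => bsumPow Lc q (W κ u κ' u'))) (AD * C + BD * g) δD)
    (HΔw : ∀ l q (W : (Fin (3 + 1) → (Fin (3 + 1) → ℤ) → Fin (3 + 1) → (Fin (3 + 1) → ℤ) → MKer (3 + 1) (Fib 3))) (C g : ℝ), q < k₀ → (fun W : (Fin (3 + 1) → (Fin (3 + 1) → ℤ) → Fin (3 + 1) → (Fin (3 + 1) → ℤ) → MKer (3 + 1) (Fib 3)) =>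
      (∀ (κ : Fin (3 + 1)) (u : Fin (3 + 1) → ℤ) (κ' : Fin (3 + 1)) (u' t : Fin (3 + 1) → ℤ),
          W κ (u + (Lc : ℤ) • t) κ' (u' + (Lc : ℤ) • t) = shiftK (-((Lc : ℤ) • t)) (W κ u κ' u')) ∧
      (∀ (N' : ℕ) (κ κ' : Fin (3 + 1)) (a b : Fib 3), zmode N' W κ κ' a b = 0) ∧
      (∃ C' δ' : ℝ, 0 < δ' ∧ LocStencil₂ W C' δ')) W →
      (∃ B : ℝ, ∀ κ u κ' u' x z a b, |W κ u κ' u' x z a b| ≤ B) → LocStencil₂ W C δ → GoodL W g →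
        LocStencil₂ (legChain (fun _ : ℕ => -((cE₂ * (Lc : ℝ) ^ (2 * (3 + 1))) * ((Lc : ℝ) ^ (3 + 1))⁻¹))
          (fun m => unitK (sfStep Lc m) (smStep 3 Lc m) (coDressKBmAt (toSite r) Lc (KInvStep (d := 3) Lc m))) Lc (l + 2) q
          (fun κ u κ' u' => bsumPow Lc q ((legStepB (fun _ : ℕ => -((cE₂ * (Lc : ℝ) ^ (2 * (3 + 1))) * ((Lc : ℝ) ^ (3 + 1))⁻¹))
              (fun m => unitK (sfStep Lc m) (smStep 3 Lc m) (coDressKBmAt (toSite r) Lc (KInvStep (d := 3) Lc m))) Lc (l + 1) W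
            - legStepB (fun _ : ℕ => -((cE₂ * (Lc : ℝ) ^ (2 * (3 + 1))) * ((Lc : ℝ) ^ (3 + 1))⁻¹))
              (fun m => unitK (sfStep Lc m) (smStep 3 Lc m) (coDressKBmAt (toSite r) Lc (KInvStep (d := 3) Lc m))) Lc l W) κ u κ' u'))) ((AΔ * C + BΔ * g) * ν ^ l) δD)
    (HS' : ∀ l, LocStencil₂ ((fun κ u κ' u' => rdiv ((((1 : ℝ) / 2) • ((fun κ u κ' u' => (cE₂ * (Lc : ℝ) ^ (2 * (3 + 1))) • mmRead Lc (K3OfK (unitK (sfStep Lc (l + 1)) (smStep 3 Lc (l + 1)) (coDressKBmAt (toSite r) Lc (KInvStep (d := 3) Lc (l + 1)))) Lc (unitS (sfStep Lc (l + 1)) (smStep 3 Lc (l + 1)) (SpureRecAt 3 Lc (toSite r) cE cVH cΛ (l + 1))) (unitM (sfStep Lc (l + 1)) (smStep 3 Lc (l + 1)) (M1At 3 Lc (toSite r) cΛ (l + 1))) (W2SymOfK (unitK (sfStep Lc (l + 1)) (smStep 3 Lc (l + 1)) (coDressKBmAt (toSite r) Lc (KInvStep (d := 3) Lc (l + 1))))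 Lc (unitS (sfStep Lc (l + 1)) (smStep 3 Lc (l + 1)) (SpureRecAt 3 Lc (toSite r) cE cVH cΛ (l + 1))) (unitM (sfStep Lc (l + 1)) (smStep 3 Lc (l + 1)) (M1At 3 Lc (toSite r) cΛ (l + 1))) 0 (unitM₂ (sfStep Lc (l + 1)) (smStep 3 Lc (l + 1)) (M2Of 3 Lc (mixFFAt (toSite r) Lc) (l + 1)))) κ u κ' u') + cB • vh₂S κ u κ' u') + (1 : ℝ) • fun κ u κ' u' => sgnK (trK (((fun κ u κ' u' => (cE₂ * (Lc : ℝ) ^ (2 * (3 + 1))) • mmRead Lc (K3OfK (unitK (sfStep Lc (l + 1)) (smStep 3 Lc (l + 1)) (coDressKBmAt (toSite r) Lc (KInvStep (d := 3) Lc (l + 1)))) Lc (unitS (sfStep Lc (l + 1)) (smStep 3 Lc (l + 1)) (SpureRecAt 3 Lc (toSite r) cE cVH cΛ (l + 1))) (unitM (sfStep Lc (l + 1)) (smStep 3 Lc (l + 1)) (M1At 3 Lc (toSite r) cΛ (l + 1))) (W2SymOfK (unitK (sfStep Lc (l + 1)) (smStep 3 Lc (l + 1)) (coDressKBmAt (toSite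 r) Lc (KInvStep (d := 3) Lc (l + 1)))) Lc (unitS (sfStep Lc (l + 1)) (smStep 3 Lc (l + 1)) (SpureRecAt 3 Lc (toSite r) cE cVH cΛ (l + 1))) (unitM (sfStep Lc (l + 1)) (smStep 3 Lc (l + 1)) (M1At 3 Lc (toSite r) cΛ (l + 1))) 0 (unitM₂ (sfStep Lc (l + 1)) (smStep 3 Lc (l + 1)) (M2Of 3 Lc (mixFFAt (toSite r) Lc) (l + 1)))) κ u κ' u') + cB • vh₂S κ u κ' u')) κ u κ' u')))) κ u κ' u')) - (fun κ u κ' u' => rdiv ((((1 : ℝ) / 2) • ((fun κ u κ' u' => (cE₂ * (Lc : ℝ) ^ (2 * (3 + 1))) • mmRead Lc (K3OfK (unitK (sfStep Lc l) (smStep 3 Lc l) (coDressKBmAt (toSite r) Lc (KInvStep (d := 3) Lc l))) Lc (unitS (sfStep Lc l) (smStep 3 Lc l) (SpureRecAt 3 Lc (toSite r) cE cVH cΛ l)) (unitM (sfStep Lc l) (smStep 3 Lc l) (M1At 3 Lc (toSite r) cΛ l)) (W2SymOfK (unitK (sfStep Lc l) (smStep 3 Lc l) (coDressKBmAt (toSite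 r) Lc (KInvStep (d := 3) Lc l))) Lc (unitS (sfStep Lc l) (smStep 3 Lc l) (SpureRecAt 3 Lc (toSite r) cE cVH cΛ l)) (unitM (sfStep Lc l) (smStep 3 Lc l) (M1At 3 Lc (toSite r) cΛ l)) 0 (unitM₂ (sfStep Lc l) (smStep 3 Lc l) (M2Of 3 Lc (mixFFAt (toSite r) Lc) l))) κ u κ' u') + cB • vh₂S κ u κ' u') + (1 : ℝ) • fun κ u κ' u' => sgnK (trK (((fun κ u κ' u' => (cE₂ * (Lc : ℝ) ^ (2 * (3 + 1))) • mmRead Lc (K3OfK (unitK (sfStep Lc l) (smStep 3 Lc l) (coDressKBmAt (toSite r) Lc (KInvStep (d := 3) Lc l))) Lc (unitS (sfStep Lc l) (smStep 3 Lc l) (SpureRecAt 3 Lc (toSite r) cE cVH cΛ l)) (unitM (sfStep Lc l) (smStep 3 Lc l) (M1At 3 Lc (toSite r) cΛ l)) (W2SymOfK (unitK (sfStep Lc l) (smStep 3 Lc l) (coDressKBmAt (toSite r) Lc (KInvStep (d := 3) Lc l))) Lc (unitS (sfStep Lc l) (smStep 3 Lc l) (SpureRecAt 3 Lc (toSite r)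 cE cVH cΛ l)) (unitM (sfStep Lc l) (smStep 3 Lc l) (M1At 3 Lc (toSite r) cΛ l)) 0 (unitM₂ (sfStep Lc l) (smStep 3 Lc l) (M2Of 3 Lc (mixFFAt (toSite r) Lc) l))) κ u κ' u') + cB • vh₂S κ u κ' u')) κ u κ' u')))) κ u κ' u'))) (CF' * ν ^ l) δS)
    (HSL' : ∀ l, GoodLS ((fun κ u κ' u' => rdiv ((((1 : ℝ) / 2) • ((fun κ u κ' u' => (cE₂ * (Lc : ℝ) ^ (2 * (3 + 1))) • mmRead Lc (K3OfK (unitK (sfStep Lc (l + 1)) (smStep 3 Lc (l + 1)) (coDressKBmAt (toSite r) Lc (KInvStep (d := 3) Lc (l + 1)))) Lc (unitS (sfStep Lc (l + 1)) (smStep 3 Lc (l + 1)) (SpureRecAt 3 Lc (toSite r) cE cVH cΛ (l + 1))) (unitM (sfStep Lc (l + 1)) (smStep 3 Lc (l + 1)) (M1At 3 Lc (toSite r) cΛ (l + 1))) (W2SymOfK (unitK (sfStep Lc (l + 1)) (smStep 3 Lc (l + 1)) (coDressKBmAt (toSite r) Lc (KInvStep (d := 3) Lc (l + 1)))) Lc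 (unitS (sfStep Lc (l + 1)) (smStep 3 Lc (l + 1)) (SpureRecAt 3 Lc (toSite r) cE cVH cΛ (l + 1))) (unitM (sfStep Lc (l + 1)) (smStep 3 Lc (l + 1)) (M1At 3 Lc (toSite r) cΛ (l + 1))) 0 (unitM₂ (sfStep Lc (l + 1)) (smStep 3 Lc (l + 1)) (M2Of 3 Lc (mixFFAt (toSite r) Lc) (l + 1)))) κ u κ' u') + cB • vh₂S κ u κ' u') + (1 : ℝ) • fun κ u κ' u' => sgnK (trK (((fun κ u κ' u' => (cE₂ * (Lc : ℝ) ^ (2 * (3 + 1))) • mmRead Lc (K3OfK (unitK (sfStep Lc (l + 1)) (smStep 3 Lc (l + 1)) (coDressKBmAt (toSite r) Lc (KInvStep (d := 3) Lc (l + 1)))) Lc (unitS (sfStep Lc (l + 1)) (smStep 3 Lc (l + 1)) (SpureRecAt 3 Lc (toSite r) cE cVH cΛ (l + 1))) (unitM (sfStep Lc (l + 1)) (smStep 3 Lc (l + 1)) (M1At 3 Lc (toSite r) cΛ (l + 1))) (W2SymOfK (unitK (sfStep Lc (l + 1)) (smStep 3 Lc (l + 1)) (coDressKBmAt (toSite r)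 Lc (KInvStep (d := 3) Lc (l + 1)))) Lc (unitS (sfStep Lc (l + 1)) (smStep 3 Lc (l + 1)) (SpureRecAt 3 Lc (toSite r) cE cVH cΛ (l + 1))) (unitM (sfStep Lc (l + 1)) (smStep 3 Lc (l + 1)) (M1At 3 Lc (toSite r) cΛ (l + 1))) 0 (unitM₂ (sfStep Lc (l + 1)) (smStep 3 Lc (l + 1)) (M2Of 3 Lc (mixFFAt (toSite r) Lc) (l + 1)))) κ u κ' u') + cB • vh₂S κ u κ' u')) κ u κ' u')))) κ u κ' u')) - (fun κ u κ' u' => rdiv ((((1 : ℝ) / 2) • ((fun κ u κ' u' => (cE₂ * (Lc : ℝ) ^ (2 * (3 + 1))) • mmRead Lc (K3OfK (unitK (sfStep Lc l) (smStep 3 Lc l) (coDressKBmAt (toSite r) Lc (KInvStep (d := 3) Lc l))) Lc (unitS (sfStep Lc l) (smStep 3 Lc l) (SpureRecAt 3 Lc (toSite r) cE cVH cΛ l)) (unitM (sfStep Lc l) (smStep 3 Lc l) (M1At 3 Lc (toSite r) cΛ l)) (W2SymOfK (unitK (sfStep Lc l) (smStep 3 Lc l) (coDressKBmAt (toSite r)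 Lc (KInvStep (d := 3) Lc l))) Lc (unitS (sfStep Lc l) (smStep 3 Lc l) (SpureRecAt 3 Lc (toSite r) cE cVH cΛ l)) (unitM (sfStep Lc l) (smStep 3 Lc l) (M1At 3 Lc (toSite r) cΛ l)) 0 (unitM₂ (sfStep Lc l) (smStep 3 Lc l) (M2Of 3 Lc (mixFFAt (toSite r) Lc) l))) κ u κ' u') + cB • vh₂S κ u κ' u') + (1 : ℝ) • fun κ u κ' u' => sgnK (trK (((fun κ u κ' u' => (cE₂ * (Lc : ℝ) ^ (2 * (3 + 1))) • mmRead Lc (K3OfK (unitK (sfStep Lc l) (smStep 3 Lc l) (coDressKBmAt (toSite r) Lc (KInvStep (d := 3) Lc l))) Lc (unitS (sfStep Lc l) (smStep 3 Lc l) (SpureRecAt 3 Lc (toSite r) cE cVH cΛ l)) (unitM (sfStep Lc l) (smStep 3 Lc l) (M1At 3 Lc (toSite r) cΛ l)) (W2SymOfK (unitK (sfStep Lc l) (smStep 3 Lc l) (coDressKBmAt (toSite r) Lc (KInvStep (d := 3) Lc l))) Lc (unitS (sfStep Lc l) (smStep 3 Lc l) (SpureRecAt 3 Lc (toSite r) cE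 cVH cΛ l)) (unitM (sfStep Lc l) (smStep 3 Lc l) (M1At 3 Lc (toSite r) cΛ l)) 0 (unitM₂ (sfStep Lc l) (smStep 3 Lc l) (M2Of 3 Lc (mixFFAt (toSite r) Lc) l))) κ u κ' u') + cB • vh₂S κ u κ' u')) κ u κ' u')))) κ u κ' u'))) (gF' * ν ^ l))
    (H3d : ∀ n, GoodLD ((fun κ u κ' u' => rdiv ((((1 : ℝ) / 2) • (unitS₂ (sfStep Lc (n + 1)) (smStep 3 Lc (n + 1)) (T2RecAt 3 Lc (toSite r) cE cVH cΛ cE₂ cB Tc vh₂S (mixFFAt (toSite r) Lc) (n + 1)) + (1 : ℝ) • fun κ u κ' u' => sgnK (trK ((unitS₂ (sfStep Lc (n + 1)) (smStep 3 Lc (n + 1)) (T2RecAt 3 Lc (toSite r) cE cVH cΛ cE₂ cB Tc vh₂S (mixFFAt (toSite r) Lc) (n + 1))) κ u κ' u')))) κ u κ' u')) - (fun κ u κ' u' => rdiv ((((1 : ℝ) / 2) • (unitS₂ (sfStep Lc n) (smStep 3 Lc n) (T2RecAt 3 Lc (toSite r) cE cVH cΛ cE₂ cB Tc vh₂S (mixFFAt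 (toSite r) Lc) n) + (1 : ℝ) • fun κ u κ' u' => sgnK (trK ((unitS₂ (sfStep Lc n) (smStep 3 Lc n) (T2RecAt 3 Lc (toSite r) cE cVH cΛ cE₂ cB Tc vh₂S (mixFFAt (toSite r) Lc) n)) κ u κ' u')))) κ u κ' u'))) (σd * ν ^ n))
    (hSrc : ∀ l : ℕ, ∃ S : Fin (3 + 1) → Fin (3 + 1) → Fin (3 + 1) → Fin (3 + 1) → ℝ,
      (∀ a b c e, S b a c e = -S a b c e) ∧ (∀ a b c e, S a b e c = -S a b c e) ∧
      ∀ κ κ' κ₁ κ₂ : Fin (3 + 1),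
      (zmode Lc ((unitS₂ (sfStep Lc ((l + 1) + 1)) (smStep 3 Lc ((l + 1) + 1)) (T2RecAt 3 Lc (toSite r) cE cVH cΛ cE₂ cB Tc vh₂S (mixFFAt (toSite r) Lc) ((l + 1) + 1)))
             - lin4 (cE₂ * (Lc : ℝ) ^ (2 * (3 + 1))) (unitK (sfStep Lc (l + 1)) (smStep 3 Lc (l + 1)) (KInvStep (d := 3) Lc (l + 1))) Lc
               (unitS₂ (sfStep Lc (l + 1)) (smStep 3 Lc (l + 1)) (T2RecAt 3 Lc (toSite r) cE cVH cΛ cE₂ cB Tc vh₂S (mixFFAt (toSite r) Lc) (l + 1)))) κ κ' (Sum.inl κ₁) (Sum.inl κ₂)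
         + zmode Lc ((unitS₂ (sfStep Lc ((l + 1) + 1)) (smStep 3 Lc ((l + 1) + 1)) (T2RecAt 3 Lc (toSite r) cE cVH cΛ cE₂ cB Tc vh₂S (mixFFAt (toSite r) Lc) ((l + 1) + 1)))
             - lin4 (cE₂ * (Lc : ℝ) ^ (2 * (3 + 1))) (unitK (sfStep Lc (l + 1)) (smStep 3 Lc (l + 1)) (KInvStep (d := 3) Lc (l + 1))) Lc
               (unitS₂ (sfStep Lc (l + 1)) (smStep 3 Lc (l + 1)) (T2RecAt 3 Lc (toSite r) cE cVH cΛ cE₂ cB Tc vh₂S (mixFFAt (toSite r) Lc) (l + 1)))) κ' κ (Sum.inl κ₁) (Sum.inl κ₂))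
      + (zmode Lc ((unitS₂ (sfStep Lc ((l + 1) + 1)) (smStep 3 Lc ((l + 1) + 1)) (T2RecAt 3 Lc (toSite r) cE cVH cΛ cE₂ cB Tc vh₂S (mixFFAt (toSite r) Lc) ((l + 1) + 1)))
             - lin4 (cE₂ * (Lc : ℝ) ^ (2 * (3 + 1))) (unitK (sfStep Lc (l + 1)) (smStep 3 Lc (l + 1)) (KInvStep (d := 3) Lc (l + 1))) Lc
               (unitS₂ (sfStep Lc (l + 1)) (smStep 3 Lc (l + 1)) (T2RecAt 3 Lc (toSite r) cE cVH cΛ cE₂ cB Tc vh₂S (mixFFAt (toSite r) Lc) (l + 1)))) κ κ' (Sum.inl κ₂) (Sum.inl κ₁)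
         + zmode Lc ((unitS₂ (sfStep Lc ((l + 1) + 1)) (smStep 3 Lc ((l + 1) + 1)) (T2RecAt 3 Lc (toSite r) cE cVH cΛ cE₂ cB Tc vh₂S (mixFFAt (toSite r) Lc) ((l + 1) + 1)))
             - lin4 (cE₂ * (Lc : ℝ) ^ (2 * (3 + 1))) (unitK (sfStep Lc (l + 1)) (smStep 3 Lc (l + 1)) (KInvStep (d := 3) Lc (l + 1))) Lc
               (unitS₂ (sfStep Lc (l + 1)) (smStep 3 Lc (l + 1)) (T2RecAt 3 Lc (toSite r) cE cVH cΛ cE₂ cB Tc vh₂S (mixFFAt (toSite r) Lc) (l + 1)))) κ' κ (Sum.inl κ₂) (Sum.inl κ₁))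
        = S κ κ₁ κ' κ₂ + S κ' κ₁ κ κ₂ + (S κ κ₂ κ' κ₁ + S κ' κ₂ κ κ₁))
    (hSrcX : ∀ (l : ℕ) (a b : Fin (3 + 1)), a ≠ b →
      (zmode Lc ((unitS₂ (sfStep Lc ((l + 1) + 1)) (smStep 3 Lc ((l + 1) + 1)) (T2RecAt 3 Lc (toSite r) cE cVH cΛ cE₂ cB Tc vh₂S (mixFFAt (toSite r) Lc) ((l + 1) + 1)))
             - lin4 (cE₂ * (Lc : ℝ) ^ (2 * (3 + 1))) (unitK (sfStep Lc (l + 1)) (smStep 3 Lc (l + 1)) (KInvStep (d := 3) Lc (l + 1))) Lc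
               (unitS₂ (sfStep Lc (l + 1)) (smStep 3 Lc (l + 1)) (T2RecAt 3 Lc (toSite r) cE cVH cΛ cE₂ cB Tc vh₂S (mixFFAt (toSite r) Lc) (l + 1)))) a b (Sum.inl a) (Sum.inl b)
         + zmode Lc ((unitS₂ (sfStep Lc ((l + 1) + 1)) (smStep 3 Lc ((l + 1) + 1)) (T2RecAt 3 Lc (toSite r) cE cVH cΛ cE₂ cB Tc vh₂S (mixFFAt (toSite r) Lc) ((l + 1) + 1)))
             - lin4 (cE₂ * (Lc : ℝ) ^ (2 * (3 + 1))) (unitK (sfStep Lc (l + 1)) (smStep 3 Lc (l + 1)) (KInvStep (d := 3) Lc (l + 1))) Lc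
               (unitS₂ (sfStep Lc (l + 1)) (smStep 3 Lc (l + 1)) (T2RecAt 3 Lc (toSite r) cE cVH cΛ cE₂ cB Tc vh₂S (mixFFAt (toSite r) Lc) (l + 1)))) b a (Sum.inl a) (Sum.inl b))
      + (zmode Lc ((unitS₂ (sfStep Lc ((l + 1) + 1)) (smStep 3 Lc ((l + 1) + 1)) (T2RecAt 3 Lc (toSite r) cE cVH cΛ cE₂ cB Tc vh₂S (mixFFAt (toSite r) Lc) ((l + 1) + 1)))
             - lin4 (cE₂ * (Lc : ℝ) ^ (2 * (3 + 1))) (unitK (sfStep Lc (l + 1)) (smStep 3 Lc (l + 1)) (KInvStep (d := 3) Lc (l + 1))) Lc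
               (unitS₂ (sfStep Lc (l + 1)) (smStep 3 Lc (l + 1)) (T2RecAt 3 Lc (toSite r) cE cVH cΛ cE₂ cB Tc vh₂S (mixFFAt (toSite r) Lc) (l + 1)))) a b (Sum.inl b) (Sum.inl a)
         + zmode Lc ((unitS₂ (sfStep Lc ((l + 1) + 1)) (smStep 3 Lc ((l + 1) + 1)) (T2RecAt 3 Lc (toSite r) cE cVH cΛ cE₂ cB Tc vh₂S (mixFFAt (toSite r) Lc) ((l + 1) + 1)))
             - lin4 (cE₂ * (Lc : ℝ) ^ (2 * (3 + 1))) (unitK (sfStep Lc (l + 1)) (smStep 3 Lc (l + 1)) (KInvStep (d := 3) Lc (l + 1))) Lc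
               (unitS₂ (sfStep Lc (l + 1)) (smStep 3 Lc (l + 1)) (T2RecAt 3 Lc (toSite r) cE cVH cΛ cE₂ cB Tc vh₂S (mixFFAt (toSite r) Lc) (l + 1)))) b a (Sum.inl b) (Sum.inl a)) = 0)
    (μ ν' : Fin 4) :
    ∃ κ θ' : ℝ, 0 ≤ θ' ∧ θ' < 1 ∧ AllScalesSeq (fun j => B12Beta.secondMoment (TbalOf Lc (JsRowD1Pin hLc N) j) μ ν') κ θ' := by
  have hLc1 : 1 ≤ Lc := by omega
  have hrb : r ∈ box (3 + 1) Lc := by rw [hr]; exact ctrOff_mem_box hLc.pos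
  have hB : ∃ C δ : ℝ, 0 < δ ∧ LocStencil₂ vh₂S C δ := by rw [hvh]; exact locStencil₂_vh₂SAn1 hLc
  have hBff : ∀ κ u κ' u' x z (α β : Fin (3 + 1)), vh₂S κ u κ' u' x z (Sum.inl α) (Sum.inl β) = 0 := by
    intro κ u κ' u' x z α β; rw [hvh]; exact vh₂SAn1_inl_inl κ u κ' u' x z α β
  have hBmm : ∀ κ u κ' u' x z (μ' ν' : Fin (3 + 1)), vh₂S κ u κ' u' x z (Sum.inr μ') (Sum.inr ν') = 0 := by
    intro κ u κ' u' x z μ' ν'; rw [hvh]; exact vh₂SAn1_inr_inr κ u κ' u' x z μ' ν'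
  have hBt : ∀ (κ : Fin (3 + 1)) (u : Fin (3 + 1) → ℤ) (κ' : Fin (3 + 1)) (u' t : Fin (3 + 1) → ℤ),
      vh₂S κ (u + (Lc : ℤ) • t) κ' (u' + (Lc : ℤ) • t) = shiftK (-((Lc : ℤ) • t)) (vh₂S κ u κ' u') := by
    intro κ u κ' u' t; rw [hvh]; exact vh₂SAn1_translate hLc1 κ u κ' u' t
  have hL := legRows_halfMember_three_of_windows hLc1 hrb cE cVH cΛ cE₂ cB Tc hBff hBmm hB hBt (ε := (1 : ℝ)) (by norm_num)
    δ δS hk hθ0 hθ1 hCg hA0 hB0 hCF hgF hC₀ hg₀ hσ H1 Hw HS HSL Hx0 HxL0 H3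
  obtain ⟨c, ϑ, -, hϑ0, hϑ1, hL₁', hL₂'⟩ := legDriftRows_halfMember_three_of_windows hLc1 hrb cE cVH cΛ cE₂ cB Tc hBff hBmm hB hBt
    (ε := (1 : ℝ)) (by norm_num) δ δS δD hk hδDδ hθ0 hθ1 hCg hA0 hB0 hCF hgF hC₀ hg₀ hσ hθD0 hθD1 hCgD hAD hBD hAΔ hBΔ hCF' hgF' hν0 hν1 hσd
    H1 Hw HS HSL Hx0 HxL0 H3 H1D HwD HΔw HS' HSL' H3d
  exact exists_allScalesSeq_JsRowD1Pin_of_QL_sourcePairForm hLc hL2 hN hr hcE hcVH hcΛ hcE₂ hcB hTc hvh hδD hϑ0.le hϑ1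
    (fun l => (hL.1 l).mono hδDδ) (fun l => (hL.2 l).mono hδDδ) hL₁' hL₂' hSrc hSrcX μ ν'

end Summit.QuantumFields.BalabanUV.Beta.GAN24.WrecAtEvenHalfRowsOfWindowsSourcePairForm

end
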